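import Literature.MathematicalPhysics.QuantumFieldTheory.Balaban1983to89.B9PerturbationMajorantAlgebra

/-!
# `Balaban1983to89.B9PerturbationL2Algebra` — [B9] p. 398 (3.46), p. 421 (3.131) IN THE L² CLASS: the weighted block-L² state classes 𝔩^{(s)},
# their majorant calculus (scalars, composition, the p. 398 transfer, weakening), and the SCHUR READINGS of the three printed-shape sup
# schemas `Thm31GpMaj` (Thm 3.1 (3.42)₁₂₃ for G′), `Proj349Maj` ((3.49)₁₂₃ for P = I − R), `CurrentMaj` ((3.117)∕(3.36) for B, B†)

T. Bałaban, *Propagators for lattice gauge theories in a background field*, Commun. Math. Phys. **99** (1985) 389–434 [`Balaban1985BackgroundPropagators`,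
"B9"]; [4] = T. Bałaban, *Propagators and renormalization transformations for lattice gauge theories. II*, Commun. Math. Phys. **96** (1984) 223–250
[`Balaban1984PropagatorsII`].  statement-level skeleton of published theorems with citation tags; proofs where landed; nothing here is a claim about
the Yang–Mills mass gap.

THE PRINT.  p. 398, (3.46): *"Finally, we have the inequalities in L²-norms ‖hG′(U)λ‖, ‖h∇_UG′(U)λ‖, ‖hG′(U)∇\*_Uλ‖, ‖hΔ_UG′(U)λ‖, ‖h∇_UG′(U)∇\*_Uλ‖,
‖hG′(U)Δ_Uλ‖ ≦ B₀[(Lʲη)², Lʲη, Lʲη, 1, 1, 1]|h|e^{−δ₀d(y,y′)}‖λ‖ for supp h ⊂ Δ(y), y ∈ Λ_j, supp λ ⊂ Δ(y′)"*; p. 398: *"the choice of powers Lʲη is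
conventional also. Using Lemma 2.1 in [4] we may replace the factor (Lʲη)^α by (Lʲη)^β(L^{j′}η)^γ with β + γ = α"*; p. 391: *"The adjoints are taken with
respect to natural L² scalar products"*; p. 422: *"[(3.131)] and Theorem 3.3 for G₀ imply a convergence of the series (3.130) … in all norms appearing on
the left-hand sides of the inequalities (3.42)–(3.47)"* — in particular in the L² norms (3.46).

THE POINT.  The Sect.-D certificate of node N06 (rows 20–21) displays the L² member of p. 422's *"in all norms"* as the binder `hstepL2 :
… → B9Thm312WholeL2.StepL2 (𝔬12 x) 1 (H x) (θ·(M_xα₀)) δK U` — the block-L² bound θ·(Lʲη)⁻¹(L^{j′}η)⁻¹e^{−δd} of the perturbation operator Δ′_π alone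
(located gap G-B9-16 ∕ C-r1g6-1).  Unlike the sup class (where Δ′_π alone has no small majorant and print moves one derivative onto the neighbouring G₀,
p. 421), in the L² class every derivative of Δ′_π = B·G′RD\* + DRG′·B† − (DRG′D\*)·B·(G′RD\*) ((3.120), dag-n06-l `B9PerturbationSplitAtLetters`) sits next
to a G′, and the block-L² bounds of the letters G′, ∇G′, G′∇\*, P, ∇P, P∇\*, B, B† FOLLOW from the sup schemas already displayed by the certificate (`h31 h49
hBJ`) by SCHUR'S TEST (dag-n06-k `B9RWSums346Schur.blockBd_schur`: row block sums = the [4]-(2.51) majorant, column block sums = the majorant of the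
TRANSPOSE; G′ and P are symmetric, (∇G′, G′∇\*), (∇P, P∇\*), (B, B†) are transpose pairs — p. 391), exactly as dag-n06-l `B9Thm312WholeL2` §1 reads
(3.46)₀,₁,₂ «NO NEW HYPOTHESIS».  The one letter Schur cannot reach is the mixed entry ∇_UG′∇\*_U ((3.42) has no sup line for it; (3.44) is Hölder) =
Theorem 3.1 (3.46)₄ — a genuinely L² input, kept DISPLAYED by the sequel.  THIS FILE (twin of dag-n06-l g14 `B9PerturbationMajorantAlgebra` §1–§2):
* §1 the WEIGHTED BLOCK-L² STATE CLASS 𝔩^{(s)} (`l2R`: size near y = (Lʲη)ˢ·‖1_{Δ(y)}·‖₂, r1's `B9SectDL2Decay.l2w` at the weight `rwt g s`; cutting cost 1)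
  and its calculus: `hasMaj_l2R_of_blockBd ∕ blockBd_of_hasMaj_l2R` (two-sided scale powers ↔ classes), `hasMaj_smul_l2R ∕ hasMaj_smul_exp_l2R` (scalars),
  `hasMaj_comp_l2R` (composition through an 𝔩-class, [4] (2.54)+(2.61)), `hasMaj_shift_l2R` (the p. 398 transfer (Lʲη)^γ, |γ| ≦ 4: rate loss αδ,
  constant L^{|γ|}, n06-k `scaleTransfer_len_rpow`);
* §2 `blockBd_of_transposePair` (SCHUR with one-sided scale powers p, q on T, Tᵗ ⟹ the block bound with the powers HALVED, p∕2 at y and q∕2 at y′)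
  and the Schur readings of the three schemas under the transpose facts: `gp_l2` (G′ : 𝔩_W^{(1)} → 𝔩_W^{(−1)}), `dvGp_l2` (∇G′ : 𝔩_W^{(1/2)} → 𝔩^{(−1/2)}),
  `gpDvs_l2` (G′∇\* : 𝔩^{(1/2)} → 𝔩_W^{(−1/2)}), `p_l2` (P : 𝔩_W^{(0)} → 𝔩_W^{(0)}), `dvP_l2` (∇P : 𝔩_W^{(−1/2)} → 𝔩^{(1/2)}), `pDvs_l2`
  (P∇\* : 𝔩^{(−1/2)} → 𝔩_W^{(1/2)}), `b_l2` (B : 𝔩_W^{(−3/2)} → 𝔩^{(3/2)}), `bd_l2` (B† : 𝔩^{(−3/2)} → 𝔩_W^{(3/2)}), and the reading `dvGpDvs_l2` of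
  the DISPLAYED L² letter (3.46)₄ (∇G′∇\* : 𝔩^{(0)} → 𝔩^{(0)}).
The six propagator letters, the words of Δ′_π and the `StepL2.t` shape are the sequel `B9PerturbationL2Letters`.
HONEST SCOPE.  Kernel-checked bookkeeping over FREE finite carriers with block maps (Schur's test + [4] (2.54), (2.60), (2.61)); Theorem 3.1, (3.49),
(3.117)∕(3.36) are HYPOTHESIS SCHEMAS (nothing of [B9] or [4] asserted); the transpose facts are hypotheses (at def-Y's trace-orthonormal coordinate
models they are the adjoint identities of p. 391); count-neutral; N06 NOT discharged; one finite lattice at a time — nothing continuum ∕ ℝ⁴ ∕ OS ∕ mass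
gap ∕ Clay.  Cell `pub-ymgap` (HUMAN RULING D-0062), Track A node N06 [B9], WIDTH-209 piece 4 (W-e `hstepL2`), seat `pub-ymgap-dag-n06-w8` (g0), 2026-08-28.
NEW file; nothing landed is modified.
-/

namespace Literature.MathematicalPhysics.QuantumFieldTheory.Balaban1983to89.B9PerturbationL2Algebra

open Literature.MathematicalPhysics.QuantumFieldTheory.Balaban1983to89
open Finset B6RandomWalk B6RandomWalkHom B9Thm34Ext B11SectG B9SectDSup B9SectDL2Decay B9Thm312Whole B9Thm312WholeClasses
open B9Thm37Glue B9RWSums343to347Whole B9RWSums346Schur B9Ineq347 B9PerturbationMajorantAlgebra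

noncomputable section

variable {g : B9.Geometry} {X V : Type} [Fintype X] [Fintype V] [Fintype g.Site]
variable {R₀ : ℝ} {H₀ : Prop}

/-! ## §1 The weighted block-L² class 𝔩^{(s)} and its majorant calculus -/

/-- **THE L² STATE CLASS 𝔩^{(s)}**: the sharp-block L² size of the lattice `X` rescaled by (Lʲη)ˢ — size of f near y = (Lʲη)ˢ·‖1_{Δ(y)}f‖₂ (r1's weighted
block-L² normed space `B9SectDL2Decay.l2w` at the real scale weight `rwt g s`; cutting cost 1).  The L² twin of `B9Thm312WholeClasses.cNormR`; the one-sided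
scale powers of (3.46) live in s. [cite: Balaban1985BackgroundPropagators, (3.46) p.398 + (3.41) p.397] -/
def l2R (R₀ : ℝ) (H₀ : Prop) (blk : X → g.Site) (hlen : ∀ y : g.Site, 0 ≤ g.len y) (s : ℝ) : BlockNorm (toB6 g R₀ H₀) (X → ℝ) :=
  l2w (toB6 g R₀ H₀) blk (rwt g s) (rwt_nonneg hlen s)

/-- The cutting cost of 𝔩^{(s)} is 1 (sharp blocks: ‖1_{Δ(y)}f‖₂ ≦ ‖f‖₂). [cite: Balaban1985BackgroundPropagators, (3.46) p.398 (bookkeeping)] -/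
@[simp] theorem l2R_κ (blk : X → g.Site) (hlen : ∀ y : g.Site, 0 ≤ g.len y) (s : ℝ) : (l2R R₀ H₀ blk hlen s).κ = 1 := rfl

/-- The local size of 𝔩^{(s)}: (Lʲη)ˢ × the sharp-block L² size. [cite: Balaban1985BackgroundPropagators, (3.46) p.398 (bookkeeping)] -/
theorem l2R_loc (blk : X → g.Site) (hlen : ∀ y : g.Site, 0 ≤ g.len y) (s : ℝ) (y : g.Site) (f : X → ℝ) :
    (l2R R₀ H₀ blk hlen s).loc y f = g.len y ^ s * bl2 (g := toB6 g R₀ H₀) blk y f := rfl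

/-- **A BLOCK-L² BOUND WITH TWO-SIDED SCALE POWERS IS A MAJORANT BETWEEN THE L² CLASSES**: ‖1_{Δ(y)}Tμ‖₂ ≦ C(y,y′)(Lʲη)ˢ(L^{j′}η)ᵗ‖μ‖₂ for
supp μ ⊂ Δ(y′) ⇒ T has the majorant C from 𝔩^{(t)} into 𝔩^{(−s)} (the scale factors moved into the sizes; r1's `hasMaj_l2w_of_blockBd`, exact).
[cite: Balaban1985BackgroundPropagators, (3.46) p.398 + p.398 (remark after (3.47))] -/
theorem hasMaj_l2R_of_blockBd (hG : GeoOK g) {blkV : V → g.Site} {blk : X → g.Site} {T : (V → ℝ) →ₗ[ℝ] (X → ℝ)}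
    {C : g.Site → g.Site → ℝ} (s t : ℝ)
    (h : BlockBd (g := toB6 g R₀ H₀) blkV blk T (fun (a b : g.Site) => C a b * g.len a ^ s * g.len b ^ t)) :
    HasMaj (l2R R₀ H₀ blkV hG.lenle t) (l2R R₀ H₀ blk hG.lenle (-s)) T C := by
  refine hasMaj_l2w_of_blockBd (rwt_nonneg hG.lenle t) (rwt_nonneg hG.lenle (-s)) h fun y y' => le_of_eq ?_
  simp only [rwt]
  rw [Real.rpow_neg (hG.lenle y)]
  have hy : g.len y ^ s ≠ 0 := (Real.rpow_pos_of_pos (hG.lenpos y) s).ne'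
  calc (g.len y ^ s)⁻¹ * (C y y' * g.len y ^ s * g.len y' ^ t) = C y y' * g.len y' ^ t * ((g.len y ^ s)⁻¹ * g.len y ^ s) := by ring
    _ = C y y' * g.len y' ^ t := by rw [inv_mul_cancel₀ hy, mul_one]

/-- **READING AN L²-CLASS MAJORANT BACK AS A BLOCK-L² BOUND**: a majorant K from 𝔩^{(t)} into 𝔩^{(s)} is the block bound K(y,y′)(Lʲη)^{−s}(L^{j′}η)ᵗ.
[cite: Balaban1985BackgroundPropagators, (3.46) p.398 + p.398 (remark after (3.47))] -/
theorem blockBd_of_hasMaj_l2R (hG : GeoOK g) {blkV : V → g.Site} {blk : X → g.Site} {T : (V → ℝ) →ₗ[ℝ] (X → ℝ)}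
    {K : g.Site → g.Site → ℝ} {s t : ℝ} (h : HasMaj (l2R R₀ H₀ blkV hG.lenle t) (l2R R₀ H₀ blk hG.lenle s) T K) :
    BlockBd (g := toB6 g R₀ H₀) blkV blk T (fun (a b : g.Site) => K a b * g.len a ^ (-s) * g.len b ^ t) := by
  have h' := blockBd_of_hasMaj_l2w (g := toB6 g R₀ H₀) h (fun y => rwt_pos hG s y)
  refine h'.mono fun y y' => le_of_eq ?_
  simp only [rwt]
  rw [Real.rpow_neg (hG.lenle y), div_eq_mul_inv]
  ring

/-- the block-L² sizes are absolutely homogeneous: size of `r • f` near y = |r| × size of f. [cite: Balaban1985BackgroundPropagators, (3.46) p.398 (bookkeeping)] -/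
theorem l2R_loc_smul (blk : X → g.Site) (hlen : ∀ y : g.Site, 0 ≤ g.len y) (s : ℝ) (y : g.Site) (r : ℝ) (f : X → ℝ) :
    (l2R R₀ H₀ blk hlen s).loc y (r • f) = |r| * (l2R R₀ H₀ blk hlen s).loc y f := by
  rw [l2R_loc, l2R_loc, bl2_smul]
  ring

/-- SCALARS: a majorant K of T into 𝔩^{(s)} is the majorant |r|·K of r•T. [cite: Balaban1985BackgroundPropagators, (3.46) p.398 (bookkeeping)] -/
theorem hasMaj_smul_l2R {F : Type} [AddCommGroup F] [Module ℝ F] {b₁ : BlockNorm (toB6 g R₀ H₀) F} {blk : X → g.Site}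
    {hlen : ∀ y : g.Site, 0 ≤ g.len y} {s : ℝ} {T : F →ₗ[ℝ] (X → ℝ)} {K : g.Site → g.Site → ℝ}
    (h : HasMaj b₁ (l2R R₀ H₀ blk hlen s) T K) (r : ℝ) :
    HasMaj b₁ (l2R R₀ H₀ blk hlen s) (r • T) (fun a b => |r| * K a b) := by
  intro y' μ hμ y
  show (l2R R₀ H₀ blk hlen s).loc y ((r • T) μ) ≤ |r| * K y y' * b₁.loc y' μ
  rw [LinearMap.smul_apply, l2R_loc_smul, mul_assoc]
  exact mul_le_mul_of_nonneg_left (h y' μ hμ y) (abs_nonneg r)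

/-- SCALARS on an exponential majorant: `w • T` has the majorant `|w|·C·e^{−rd}` into 𝔩^{(s)}. [cite: Balaban1985BackgroundPropagators, (3.46) p.398 (bookkeeping)] -/
theorem hasMaj_smul_exp_l2R {F : Type} [AddCommGroup F] [Module ℝ F] {b₁ : BlockNorm (toB6 g R₀ H₀) F} {blk : X → g.Site}
    {hlen : ∀ y : g.Site, 0 ≤ g.len y} {s : ℝ} {T : F →ₗ[ℝ] (X → ℝ)} {C r : ℝ}
    (h : HasMaj b₁ (l2R R₀ H₀ blk hlen s) T (fun a b => C * Real.exp (-(r * g.dist a b)))) (w : ℝ) :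
    HasMaj b₁ (l2R R₀ H₀ blk hlen s) (w • T) (fun a b => |w| * C * Real.exp (-(r * g.dist a b))) :=
  (hasMaj_smul_l2R h w).mono fun a b => by
    show |w| * (C * Real.exp (-(r * g.dist a b))) ≤ |w| * C * Real.exp (-(r * g.dist a b))
    exact le_of_eq (mul_assoc _ _ _).symm

/-- **COMPOSITION THROUGH AN L² CLASS** ([4] (2.52)–(2.56) + Lemma 2.1 (2.61) at the margin σ; the classes 𝔩^{(s)} cut at cost 1): T₁ (majorant a₁e^{−ρ₁d}
out of 𝔩^{(s)}) after T₂ (majorant a₂e^{−ρ₂d} into 𝔩^{(s)}) has the majorant a₁a₂c·e^{−ρd} for 0 ≦ ρ ≦ ρ₂, ρ + σ ≦ ρ₁.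
[cite: Balaban1984PropagatorsII, (2.52)–(2.56) pp.232–233, Lemma 2.1 (2.61) p.234] -/
theorem hasMaj_comp_l2R (hG : GeoOK g) {F₁ F₃ : Type} [AddCommGroup F₁] [Module ℝ F₁] [AddCommGroup F₃] [Module ℝ F₃]
    {b₁ : BlockNorm (toB6 g R₀ H₀) F₁} {b₃ : BlockNorm (toB6 g R₀ H₀) F₃} {blk : X → g.Site} {s : ℝ}
    {T₁ : (X → ℝ) →ₗ[ℝ] F₃} {T₂ : F₁ →ₗ[ℝ] (X → ℝ)} {a₁ a₂ ρ₁ ρ₂ ρ σ c : ℝ} (hrow : RowSum (toB6 g R₀ H₀) σ c)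
    (ha₁ : 0 ≤ a₁) (ha₂ : 0 ≤ a₂) (hρ : 0 ≤ ρ) (hρ₂ : ρ ≤ ρ₂) (hρ₁ : ρ + σ ≤ ρ₁)
    (h₁ : HasMaj (l2R R₀ H₀ blk hG.lenle s) b₃ T₁ (fun a b => a₁ * Real.exp (-(ρ₁ * g.dist a b))))
    (h₂ : HasMaj b₁ (l2R R₀ H₀ blk hG.lenle s) T₂ (fun a b => a₂ * Real.exp (-(ρ₂ * g.dist a b)))) :
    HasMaj b₁ b₃ (T₁ ∘ₗ T₂) (fun a b => a₁ * a₂ * c * Real.exp (-(ρ * g.dist a b))) := by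
  have htri : Triangle254 (toB6 g R₀ H₀) := fun a b c => hG.tri a b c
  refine (hasMaj_comp_exp htri hG.dnn hrow ha₁ ha₂ hρ hρ₂ hρ₁ h₁ h₂).mono fun a b => le_of_eq ?_
  simp only [l2R_κ, toB6_dist]
  ring

/-- **THE SCALE TRANSFER OF p. 398 WITH AN ADDITIVE RATE LOSS, L² CLASSES**: a majorant C·e^{−rd} from 𝔩_V^{(t)} to 𝔩^{(s)} is the majorant
C·L^{|γ|}·e^{−(r−αδ)d} from 𝔩_V^{(t+γ)} to 𝔩^{(s+γ)}, |γ| ≦ 4, under the member facts ([4] (2.60) at the exponent α for the rate δ, 4·log L ≦ αδRM; n06-k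
`B9RWSums346Schur.scaleTransfer_len_rpow`). [cite: Balaban1985BackgroundPropagators, p.398 (remark after (3.47)); Balaban1984PropagatorsII, Lemma 2.1 (2.60) p.234] -/
theorem hasMaj_shift_l2R (hG : GeoOK g) {dF : ℕ} {δ α L₀ : ℝ} (hF : Facts347 g R₀ H₀ dF δ α L₀)
    {blkV : V → g.Site} {blk : X → g.Site} {T : (V → ℝ) →ₗ[ℝ] (X → ℝ)} {C r s t : ℝ} (γ : ℝ) (hγ : |γ| ≤ 4) (hC : 0 ≤ C)
    (h : HasMaj (l2R R₀ H₀ blkV hG.lenle t) (l2R R₀ H₀ blk hG.lenle s) T (fun a b => C * Real.exp (-(r * g.dist a b)))) :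
    HasMaj (l2R R₀ H₀ blkV hG.lenle (t + γ)) (l2R R₀ H₀ blk hG.lenle (s + γ)) T
      (fun a b => C * g.L ^ |γ| * Real.exp (-((r - α * δ) * g.dist a b))) := by
  intro y' μ hμ y
  have hb := h y' μ hμ y
  rw [l2R_loc, l2R_loc] at hb
  rw [l2R_loc, l2R_loc, Real.rpow_add (hG.lenpos y), Real.rpow_add (hG.lenpos y')]
  set N := bl2 (g := toB6 g R₀ H₀) blk y (T μ) with hN
  set N' := bl2 (g := toB6 g R₀ H₀) blkV y' μ with hN'
  have hN'0 : 0 ≤ N' := bl2_nonneg _ _ _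
  have hγ0 : 0 ≤ g.len y ^ γ := Real.rpow_nonneg (hG.lenle y) γ
  have ht0 : 0 ≤ g.len y' ^ t := Real.rpow_nonneg (hG.lenle y') t
  -- the transfer at (y′, y): e^{−αδd(y,y′)} (Lʲη)^γ ≦ L^{|γ|} (L^{j′}η)^γ
  have hst : Real.exp (-(α * δ * g.dist y y')) * g.len y ^ γ ≤ g.L ^ |γ| * g.len y' ^ γ := by
    have h1 := scaleTransfer_len_rpow hF γ hγ y' y
    rw [hG.symm y' y] at h1
    exact h1
  have hsplit : Real.exp (-(r * g.dist y y')) =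
      Real.exp (-((r - α * δ) * g.dist y y')) * Real.exp (-(α * δ * g.dist y y')) := by
    rw [← Real.exp_add]; congr 1; ring
  have hE : 0 ≤ C * Real.exp (-((r - α * δ) * g.dist y y')) := mul_nonneg hC (Real.exp_nonneg _)
  calc g.len y ^ s * g.len y ^ γ * N = g.len y ^ γ * (g.len y ^ s * N) := by ring
    _ ≤ g.len y ^ γ * (C * Real.exp (-(r * g.dist y y')) * (g.len y' ^ t * N')) := mul_le_mul_of_nonneg_left hb hγ0
    _ = C * Real.exp (-((r - α * δ) * g.dist y y')) * (Real.exp (-(α * δ * g.dist y y')) * g.len y ^ γ) * (g.len y' ^ t * N') := by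
        rw [hsplit]; ring
    _ ≤ C * Real.exp (-((r - α * δ) * g.dist y y')) * (g.L ^ |γ| * g.len y' ^ γ) * (g.len y' ^ t * N') :=
        mul_le_mul_of_nonneg_right (mul_le_mul_of_nonneg_left hst hE) (mul_nonneg ht0 hN'0)
    _ = C * g.L ^ |γ| * Real.exp (-((r - α * δ) * g.dist y y')) * (g.len y' ^ t * g.len y' ^ γ * N') := by ring

/-- the transfer with a NATURAL bound on the constant: for |γ| ≦ n ≦ 4 the constant L^{|γ|} is at most Lⁿ (L ≧ 1).
[cite: Balaban1985BackgroundPropagators, p.398 (remark after (3.47)); Balaban1984PropagatorsII, Lemma 2.1 (2.60) p.234] -/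
theorem hasMaj_shift_l2R_nat (hG : GeoOK g) {dF : ℕ} {δ α L₀ : ℝ} (hF : Facts347 g R₀ H₀ dF δ α L₀)
    {blkV : V → g.Site} {blk : X → g.Site} {T : (V → ℝ) →ₗ[ℝ] (X → ℝ)} {C r s t : ℝ} (γ : ℝ) (n : ℕ) (hγ : |γ| ≤ n) (hn : n ≤ 4)
    (hC : 0 ≤ C) (h : HasMaj (l2R R₀ H₀ blkV hG.lenle t) (l2R R₀ H₀ blk hG.lenle s) T (fun a b => C * Real.exp (-(r * g.dist a b)))) :
    HasMaj (l2R R₀ H₀ blkV hG.lenle (t + γ)) (l2R R₀ H₀ blk hG.lenle (s + γ)) T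
      (fun a b => C * g.L ^ n * Real.exp (-((r - α * δ) * g.dist a b))) := by
  have hn' : (n : ℝ) ≤ 4 := by exact_mod_cast hn
  refine (hasMaj_shift_l2R hG hF γ (hγ.trans hn') hC h).mono fun a b => ?_
  have hL : g.L ^ |γ| ≤ g.L ^ n := by
    rw [← Real.rpow_natCast]
    exact Real.rpow_le_rpow_of_exponent_le hF.one_le_L hγ
  exact mul_le_mul_of_nonneg_right (mul_le_mul_of_nonneg_left hL hC) (Real.exp_nonneg _)

/-- block-L² bounds ADD (‖1_{Δ(y)}(T₁ + T₂)μ‖₂ ≦ ‖1_{Δ(y)}T₁μ‖₂ + ‖1_{Δ(y)}T₂μ‖₂). [cite: Balaban1985BackgroundPropagators, (3.46) p.398 (bookkeeping)] -/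
theorem blockBd_add {X₁ X₂ : Type} [Fintype X₁] [Fintype X₂] {blk₁ : X₁ → g.Site} {blk₂ : X₂ → g.Site}
    {T₁ T₂ : (X₁ → ℝ) →ₗ[ℝ] (X₂ → ℝ)} {N₁ N₂ : g.Site → g.Site → ℝ}
    (h₁ : BlockBd (g := toB6 g R₀ H₀) blk₁ blk₂ T₁ N₁) (h₂ : BlockBd (g := toB6 g R₀ H₀) blk₁ blk₂ T₂ N₂) :
    BlockBd (g := toB6 g R₀ H₀) blk₁ blk₂ (T₁ + T₂) (fun (y y' : g.Site) => N₁ y y' + N₂ y y') := by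
  intro y' μ hμ y
  rw [LinearMap.add_apply, add_mul]
  exact (bl2_add_le _ _ _ _).trans (add_le_add (h₁ y' μ hμ y) (h₂ y' μ hμ y))

/-! ## §2 Schur's test with one-sided scale powers, and the L² readings of the three sup schemas -/

omit [Fintype X] [Fintype V] [Fintype g.Site] in
/-- the square behind Schur's geometric mean: (C·(Lʲη)^{p/2}(L^{j′}η)^{q/2}e^{−rd})² = (C(Lʲη)ᵖe^{−rd})·(C(L^{j′}η)^{q}e^{−rd}).
[cite: Balaban1985BackgroundPropagators, (3.46) p.398 (bookkeeping)] -/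
private theorem schur_sq (hG : GeoOK g) (C p q r : ℝ) (y y' : g.Site) :
    (C * g.len y ^ p * Real.exp (-(r * g.dist y y'))) * (C * g.len y' ^ q * Real.exp (-(r * g.dist y' y))) =
      (C * g.len y ^ (p / 2) * g.len y' ^ (q / 2) * Real.exp (-(r * g.dist y y'))) ^ 2 := by
  have hp : g.len y ^ p = (g.len y ^ (p / 2)) ^ 2 := by
    rw [← Real.rpow_two, ← Real.rpow_mul (hG.lenle y)]; congr 1; ring
  have hq : g.len y' ^ q = (g.len y' ^ (q / 2)) ^ 2 := by
    rw [← Real.rpow_two, ← Real.rpow_mul (hG.lenle y')]; congr 1; ring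
  rw [hG.symm y' y, hp, hq]
  ring

/-- **SCHUR'S TEST WITH ONE-SIDED SCALE POWERS.**  If T : (X₁ → ℝ) → (X₂ → ℝ) has the [4]-(2.51) majorant C(Lʲη)ᵖe^{−rd(y,y′)} (power at the OUTPUT block,
as printed in (3.42), (3.49)) and its transpose Tᵗ (p. 391's L² adjoint, `IsTransposePair T Tᵗ`) has the majorant C(Lʲη)^{q}e^{−rd}, then
‖1_{Δ(y)}Tμ‖₂ ≦ C(Lʲη)^{p/2}(L^{j′}η)^{q/2}e^{−rd(y,y′)}‖μ‖₂ for supp μ ⊂ Δ(y′) — n06-k's `blockBd_schur` (√(row · column)) with the square root taken.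
[cite: Balaban1985BackgroundPropagators, (3.46) p.398 + (3.42) p.397 + p.391; Schur's test, folklore] -/
theorem blockBd_of_transposePair (hG : GeoOK g) {X₁ X₂ : Type} [Fintype X₁] [Fintype X₂] {blk₁ : X₁ → g.Site} {blk₂ : X₂ → g.Site}
    {T : (X₁ → ℝ) →ₗ[ℝ] (X₂ → ℝ)} {T' : (X₂ → ℝ) →ₗ[ℝ] (X₁ → ℝ)} {C p q r : ℝ} (hC : 0 ≤ C)
    (hT : HasMajorantHom (g := toB6 g R₀ H₀) blk₁ blk₂ T (fun (a b : g.Site) => C * g.len a ^ p * Real.exp (-(r * g.dist a b))))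
    (hT' : HasMajorantHom (g := toB6 g R₀ H₀) blk₂ blk₁ T' (fun (a b : g.Site) => C * g.len a ^ q * Real.exp (-(r * g.dist a b))))
    (hadj : IsTransposePair T T') :
    BlockBd (g := toB6 g R₀ H₀) blk₁ blk₂ T
      (fun (y y' : g.Site) => C * g.len y ^ (p / 2) * g.len y' ^ (q / 2) * Real.exp (-(r * g.dist y y'))) := by
  have hK : ∀ a b : g.Site, 0 ≤ C * g.len a ^ p * Real.exp (-(r * g.dist a b)) := fun a b =>
    mul_nonneg (mul_nonneg hC (Real.rpow_nonneg (hG.lenle a) p)) (Real.exp_nonneg _)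
  have hK' : ∀ a b : g.Site, 0 ≤ C * g.len a ^ q * Real.exp (-(r * g.dist a b)) := fun a b =>
    mul_nonneg (mul_nonneg hC (Real.rpow_nonneg (hG.lenle a) q)) (Real.exp_nonneg _)
  have hS := blockBd_schur (G := toB6 g R₀ H₀) blk₁ blk₂ hK hK' hT hT' hadj
  refine hS.mono fun y y' => le_of_eq ?_
  have hnn : 0 ≤ C * g.len y ^ (p / 2) * g.len y' ^ (q / 2) * Real.exp (-(r * g.dist y y')) :=
    mul_nonneg (mul_nonneg (mul_nonneg hC (Real.rpow_nonneg (hG.lenle y) _)) (Real.rpow_nonneg (hG.lenle y') _)) (Real.exp_nonneg _)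
  show Real.sqrt ((C * g.len y ^ p * Real.exp (-(r * g.dist y y'))) * (C * g.len y' ^ q * Real.exp (-(r * g.dist y' y)))) = _
  rw [schur_sq hG C p q r y y', Real.sqrt_sq hnn]

/-- **SCHUR, READ IN THE L² CLASSES**: under the hypotheses of `blockBd_of_transposePair`, T : 𝔩^{(q/2)} → 𝔩^{(−p/2)} with the majorant C·e^{−rd}.
[cite: Balaban1985BackgroundPropagators, (3.46) p.398 + (3.42) p.397 + p.391] -/
theorem hasMaj_l2R_of_transposePair (hG : GeoOK g) {X₁ X₂ : Type} [Fintype X₁] [Fintype X₂] {blk₁ : X₁ → g.Site} {blk₂ : X₂ → g.Site}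
    {T : (X₁ → ℝ) →ₗ[ℝ] (X₂ → ℝ)} {T' : (X₂ → ℝ) →ₗ[ℝ] (X₁ → ℝ)} {C p q r : ℝ} (hC : 0 ≤ C)
    (hT : HasMajorantHom (g := toB6 g R₀ H₀) blk₁ blk₂ T (fun (a b : g.Site) => C * g.len a ^ p * Real.exp (-(r * g.dist a b))))
    (hT' : HasMajorantHom (g := toB6 g R₀ H₀) blk₂ blk₁ T' (fun (a b : g.Site) => C * g.len a ^ q * Real.exp (-(r * g.dist a b))))
    (hadj : IsTransposePair T T') :
    HasMaj (l2R R₀ H₀ blk₁ hG.lenle (q / 2)) (l2R R₀ H₀ blk₂ hG.lenle (-(p / 2))) T (fun a b => C * Real.exp (-(r * g.dist a b))) :=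
  hasMaj_l2R_of_blockBd hG (p / 2) (q / 2)
    ((blockBd_of_transposePair hG hC hT hT' hadj).mono fun y y' => le_of_eq (by ring))

section Readings

variable {XS XB : Type} [Fintype XS] [Fintype XB]
variable {blkW : XS → g.Site} {blk : XB → g.Site} {Gp P : Module.End ℝ (XS → ℝ)} {Dv : (XS → ℝ) →ₗ[ℝ] (XB → ℝ)}
  {Dvs : (XB → ℝ) →ₗ[ℝ] (XS → ℝ)} {Bop : (XS → ℝ) →ₗ[ℝ] (XB → ℝ)} {Bdop : (XB → ℝ) →ₗ[ℝ] (XS → ℝ)}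
  {B₀ δ₀ CP δP tB δB B₄ δ₄ r : ℝ}

omit [Fintype X] [Fintype V] [Fintype g.Site] in
/-- `(Lʲη)⁻¹ = (Lʲη)^{−1}` as a real power. [cite: Balaban1985BackgroundPropagators, (3.41) p.397 (bookkeeping)] -/
private theorem len_inv_rpow (a : g.Site) : (g.len a)⁻¹ = g.len a ^ (-1 : ℝ) := by
  rw [Real.rpow_neg_one]

omit [Fintype X] [Fintype V] [Fintype g.Site] in
/-- `((Lʲη)³)⁻¹ = (Lʲη)^{−3}` as a real power. [cite: Balaban1985BackgroundPropagators, (3.41) p.397 (bookkeeping)] -/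
private theorem len_cube_inv_rpow (hG : GeoOK g) (a : g.Site) : (g.len a ^ 3)⁻¹ = g.len a ^ (-3 : ℝ) := by
  rw [Real.rpow_neg (hG.lenle a), ← Real.rpow_natCast]
  norm_num

omit [Fintype X] [Fintype V] [Fintype XB] in
/-- **(3.46)₀ FOR G′ FROM (3.42)₁ AND THE SYMMETRY OF G′** (Schur): G′ : 𝔩_W^{(1)} → 𝔩_W^{(−1)} with B₀e^{−rd}, r ≦ δ₀ — i.e. ‖1_{Δ(y)}G′λ‖₂ ≦
B₀·Lʲη·L^{j′}η·e^{−δ₀d}‖λ‖₂, the symmetrised split of the printed (Lʲη)² (p. 398; Thm 3.1: G′(U) *"is a symmetric and invertible operator"*).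
[cite: Balaban1985BackgroundPropagators, (3.46) p.398 + Thm 3.1 (3.42) p.397 + p.391] -/
theorem gp_l2 (hG : GeoOK g) (h : Thm31GpMaj blkW blk Gp Dv Dvs R₀ H₀ B₀ δ₀) (hsym : IsTransposePair Gp Gp) (hB₀ : 0 ≤ B₀) (hr : r ≤ δ₀) :
    HasMaj (l2R R₀ H₀ blkW hG.lenle 1) (l2R R₀ H₀ blkW hG.lenle (-1)) Gp (fun a b => B₀ * Real.exp (-(r * g.dist a b))) := by
  have e0 : HasMajorantHom (g := toB6 g R₀ H₀) blkW blkW Gp (fun (a b : g.Site) => B₀ * g.len a ^ (2 : ℝ) * Real.exp (-(δ₀ * g.dist a b))) :=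
    hasMajorantHom_mono (g := toB6 g R₀ H₀) blkW blkW ((hasMajorantHom_iff (g := toB6 g R₀ H₀) blkW Gp _).mpr h.e0)
      fun a b => le_of_eq (by rw [Real.rpow_two])
  have h2 := hasMaj_l2R_of_transposePair hG hB₀ e0 e0 hsym
  rw [show (2 : ℝ) / 2 = 1 by norm_num] at h2
  exact hasMaj_weaken hG hB₀ le_rfl hr h2

omit [Fintype X] [Fintype V] in
/-- **(3.46)₁ FOR G′ FROM (3.42)₂, (3.42)₃ AND THE TRANSPOSITION (∇G′)ᵗ = G′∇\*** (Schur): ∇_UG′ : 𝔩_W^{(1/2)} → 𝔩^{(−1/2)} with B₀e^{−rd}, r ≦ δ₀ —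
‖1_{Δ(y)}∇G′λ‖₂ ≦ B₀(LʲηL^{j′}η)^{1/2}e^{−δ₀d}‖λ‖₂, the symmetric split of the printed Lʲη (p. 398: *"we may always replace ∇_U by ∇\*_U, and vice versa"*).
[cite: Balaban1985BackgroundPropagators, (3.46) p.398 + Thm 3.1 (3.42) p.397 + p.391] -/
theorem dvGp_l2 (hG : GeoOK g) (h : Thm31GpMaj blkW blk Gp Dv Dvs R₀ H₀ B₀ δ₀) (hadj : IsTransposePair (Dv ∘ₗ Gp) (Gp ∘ₗ Dvs))
    (hB₀ : 0 ≤ B₀) (hr : r ≤ δ₀) :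
    HasMaj (l2R R₀ H₀ blkW hG.lenle (1 / 2)) (l2R R₀ H₀ blk hG.lenle (-(1 / 2))) (Dv ∘ₗ Gp)
      (fun a b => B₀ * Real.exp (-(r * g.dist a b))) := by
  have e1 : HasMajorantHom (g := toB6 g R₀ H₀) blkW blk (Dv ∘ₗ Gp) (fun (a b : g.Site) => B₀ * g.len a ^ (1 : ℝ) * Real.exp (-(δ₀ * g.dist a b))) :=
    hasMajorantHom_mono (g := toB6 g R₀ H₀) blkW blk h.e1 fun a b => le_of_eq (by rw [Real.rpow_one])
  have e2 : HasMajorantHom (g := toB6 g R₀ H₀) blk blkW (Gp ∘ₗ Dvs) (fun (a b : g.Site) => B₀ * g.len a ^ (1 : ℝ) * Real.exp (-(δ₀ * g.dist a b))) :=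
    hasMajorantHom_mono (g := toB6 g R₀ H₀) blk blkW h.e2 fun a b => le_of_eq (by rw [Real.rpow_one])
  exact hasMaj_weaken hG hB₀ le_rfl hr (hasMaj_l2R_of_transposePair hG hB₀ e1 e2 hadj)

omit [Fintype X] [Fintype V] in
/-- **(3.46)₂ FOR G′ FROM (3.42)₃, (3.42)₂ AND THE TRANSPOSITION (G′∇\*)ᵗ = ∇G′** (Schur): G′∇\*_U : 𝔩^{(1/2)} → 𝔩_W^{(−1/2)} with B₀e^{−rd}, r ≦ δ₀.
[cite: Balaban1985BackgroundPropagators, (3.46) p.398 + Thm 3.1 (3.42) p.397 + p.391] -/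
theorem gpDvs_l2 (hG : GeoOK g) (h : Thm31GpMaj blkW blk Gp Dv Dvs R₀ H₀ B₀ δ₀) (hadj : IsTransposePair (Dv ∘ₗ Gp) (Gp ∘ₗ Dvs))
    (hB₀ : 0 ≤ B₀) (hr : r ≤ δ₀) :
    HasMaj (l2R R₀ H₀ blk hG.lenle (1 / 2)) (l2R R₀ H₀ blkW hG.lenle (-(1 / 2))) (Gp ∘ₗ Dvs)
      (fun a b => B₀ * Real.exp (-(r * g.dist a b))) := by
  have e1 : HasMajorantHom (g := toB6 g R₀ H₀) blkW blk (Dv ∘ₗ Gp) (fun (a b : g.Site) => B₀ * g.len a ^ (1 : ℝ) * Real.exp (-(δ₀ * g.dist a b))) :=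
    hasMajorantHom_mono (g := toB6 g R₀ H₀) blkW blk h.e1 fun a b => le_of_eq (by rw [Real.rpow_one])
  have e2 : HasMajorantHom (g := toB6 g R₀ H₀) blk blkW (Gp ∘ₗ Dvs) (fun (a b : g.Site) => B₀ * g.len a ^ (1 : ℝ) * Real.exp (-(δ₀ * g.dist a b))) :=
    hasMajorantHom_mono (g := toB6 g R₀ H₀) blk blkW h.e2 fun a b => le_of_eq (by rw [Real.rpow_one])
  exact hasMaj_weaken hG hB₀ le_rfl hr (hasMaj_l2R_of_transposePair hG hB₀ e2 e1 hadj.symm)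

/-- **THEOREM 3.1, THE MIXED L² ENTRY (3.46)₄ FOR G′** — ‖1_{Δ(y)}∇_UG′(U)∇\*_Uλ‖₂ ≦ B₄e^{−δ₄d(y,y′)}‖λ‖₂ for supp λ ⊂ Δ(y′) (printed constant B₀·1) —
as r1's block-L² bound of the model operator ∇_U∘G′∘∇\*_U.  The ONE genuinely L² input of the L² step: (3.42) has no sup line for ∇G′∇\* (its sup form
(3.44) needs the Hölder data of the input), so Schur's test cannot read it off the displayed sup schemas.  A HYPOTHESIS SCHEMA of printed shape; nothing
asserted (at def-Y's G′ its derivation is the Agmon ∕ (3.35)-regularity road of dag-n06-w1's `B9Thm31Site*Reg335Y` files).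
[cite: Balaban1985BackgroundPropagators, Thm 3.1 (3.46) p.398 + (3.44) p.398] -/
structure Thm31GpL2Mixed (blk : XB → g.Site) (Gp : Module.End ℝ (XS → ℝ)) (Dv : (XS → ℝ) →ₗ[ℝ] (XB → ℝ)) (Dvs : (XB → ℝ) →ₗ[ℝ] (XS → ℝ))
    (R₀ : ℝ) (H₀ : Prop) (B₄ δ₄ : ℝ) : Prop where
  e4 : BlockBd (g := toB6 g R₀ H₀) blk blk (Dv ∘ₗ Gp ∘ₗ Dvs) (fun (y y' : g.Site) => B₄ * Real.exp (-(δ₄ * g.dist y y')))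

omit [Fintype X] [Fintype V] [Fintype XS] in
/-- the mixed entry read in the L² classes: ∇_UG′∇\*_U : 𝔩^{(0)} → 𝔩^{(0)} with B₄e^{−rd}, r ≦ δ₄. [cite: Balaban1985BackgroundPropagators, Thm 3.1 (3.46) p.398] -/
theorem dvGpDvs_l2 (hG : GeoOK g) (h : Thm31GpL2Mixed blk Gp Dv Dvs R₀ H₀ B₄ δ₄) (hB₄ : 0 ≤ B₄) (hr : r ≤ δ₄) :
    HasMaj (l2R R₀ H₀ blk hG.lenle 0) (l2R R₀ H₀ blk hG.lenle 0) (Dv ∘ₗ Gp ∘ₗ Dvs) (fun a b => B₄ * Real.exp (-(r * g.dist a b))) := by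
  have h0 : BlockBd (g := toB6 g R₀ H₀) blk blk (Dv ∘ₗ Gp ∘ₗ Dvs)
      (fun (a b : g.Site) => B₄ * Real.exp (-(δ₄ * g.dist a b)) * g.len a ^ (0 : ℝ) * g.len b ^ (0 : ℝ)) :=
    h.e4.mono fun y y' => le_of_eq (by rw [Real.rpow_zero, Real.rpow_zero, mul_one, mul_one])
  have h1 := hasMaj_l2R_of_blockBd hG (0 : ℝ) (0 : ℝ) h0
  rw [neg_zero] at h1
  exact hasMaj_weaken hG hB₄ le_rfl hr h1

omit [Fintype X] [Fintype V] [Fintype XB] in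
/-- **(3.49)₁ IN L² FROM THE SYMMETRY OF P** (Schur): P : 𝔩_W^{(0)} → 𝔩_W^{(0)} with C_Pe^{−rd}, r ≦ δ_P (P = I − R is an orthogonal projection in print,
hence symmetric; R symmetric is among the p. 425 identities). [cite: Balaban1985BackgroundPropagators, (3.49) p.399 + p.391 + p.425] -/
theorem p_l2 (hG : GeoOK g) (h : Proj349Maj blkW blk P Dv Dvs R₀ H₀ CP δP) (hsym : IsTransposePair P P) (hCP : 0 ≤ CP) (hr : r ≤ δP) :
    HasMaj (l2R R₀ H₀ blkW hG.lenle 0) (l2R R₀ H₀ blkW hG.lenle 0) P (fun a b => CP * Real.exp (-(r * g.dist a b))) := by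
  have p0 : HasMajorantHom (g := toB6 g R₀ H₀) blkW blkW P (fun (a b : g.Site) => CP * g.len a ^ (0 : ℝ) * Real.exp (-(δP * g.dist a b))) :=
    hasMajorantHom_mono (g := toB6 g R₀ H₀) blkW blkW ((hasMajorantHom_iff (g := toB6 g R₀ H₀) blkW P _).mpr h.p0)
      fun a b => le_of_eq (by rw [Real.rpow_zero, mul_one])
  have h2 := hasMaj_l2R_of_transposePair hG hCP p0 p0 hsym
  rw [show (0 : ℝ) / 2 = 0 by norm_num, neg_zero] at h2
  exact hasMaj_weaken hG hCP le_rfl hr h2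

omit [Fintype X] [Fintype V] in
/-- **(3.49)₂ IN L² FROM (3.49)₂,₃ AND THE TRANSPOSITION (∇P)ᵗ = P∇\*** (Schur): ∇P : 𝔩_W^{(−1/2)} → 𝔩^{(1/2)} with C_Pe^{−rd}, r ≦ δ_P — the printed (Lʲη)⁻¹
split symmetrically. [cite: Balaban1985BackgroundPropagators, (3.49) p.399 + p.391] -/
theorem dvP_l2 (hG : GeoOK g) (h : Proj349Maj blkW blk P Dv Dvs R₀ H₀ CP δP) (hadj : IsTransposePair (Dv ∘ₗ P) (P ∘ₗ Dvs))
    (hCP : 0 ≤ CP) (hr : r ≤ δP) :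
    HasMaj (l2R R₀ H₀ blkW hG.lenle (-(1 / 2))) (l2R R₀ H₀ blk hG.lenle (1 / 2)) (Dv ∘ₗ P)
      (fun a b => CP * Real.exp (-(r * g.dist a b))) := by
  have p1 : HasMajorantHom (g := toB6 g R₀ H₀) blkW blk (Dv ∘ₗ P) (fun (a b : g.Site) => CP * g.len a ^ (-1 : ℝ) * Real.exp (-(δP * g.dist a b))) :=
    hasMajorantHom_mono (g := toB6 g R₀ H₀) blkW blk h.p1 fun a b => le_of_eq (by rw [len_inv_rpow])
  have p2 : HasMajorantHom (g := toB6 g R₀ H₀) blk blkW (P ∘ₗ Dvs) (fun (a b : g.Site) => CP * g.len a ^ (-1 : ℝ) * Real.exp (-(δP * g.dist a b))) :=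
    hasMajorantHom_mono (g := toB6 g R₀ H₀) blk blkW h.p2 fun a b => le_of_eq (by rw [len_inv_rpow])
  have h2 := hasMaj_l2R_of_transposePair hG hCP p1 p2 hadj
  rw [show -((-1 : ℝ) / 2) = 1 / 2 by norm_num, show (-1 : ℝ) / 2 = -(1 / 2) by norm_num] at h2
  exact hasMaj_weaken hG hCP le_rfl hr h2

omit [Fintype X] [Fintype V] in
/-- **(3.49)₃ IN L²** (Schur, the transposed pair): P∇\* : 𝔩^{(−1/2)} → 𝔩_W^{(1/2)} with C_Pe^{−rd}, r ≦ δ_P. [cite: Balaban1985BackgroundPropagators, (3.49) p.399 + p.391] -/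
theorem pDvs_l2 (hG : GeoOK g) (h : Proj349Maj blkW blk P Dv Dvs R₀ H₀ CP δP) (hadj : IsTransposePair (Dv ∘ₗ P) (P ∘ₗ Dvs))
    (hCP : 0 ≤ CP) (hr : r ≤ δP) :
    HasMaj (l2R R₀ H₀ blk hG.lenle (-(1 / 2))) (l2R R₀ H₀ blkW hG.lenle (1 / 2)) (P ∘ₗ Dvs)
      (fun a b => CP * Real.exp (-(r * g.dist a b))) := by
  have p1 : HasMajorantHom (g := toB6 g R₀ H₀) blkW blk (Dv ∘ₗ P) (fun (a b : g.Site) => CP * g.len a ^ (-1 : ℝ) * Real.exp (-(δP * g.dist a b))) :=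
    hasMajorantHom_mono (g := toB6 g R₀ H₀) blkW blk h.p1 fun a b => le_of_eq (by rw [len_inv_rpow])
  have p2 : HasMajorantHom (g := toB6 g R₀ H₀) blk blkW (P ∘ₗ Dvs) (fun (a b : g.Site) => CP * g.len a ^ (-1 : ℝ) * Real.exp (-(δP * g.dist a b))) :=
    hasMajorantHom_mono (g := toB6 g R₀ H₀) blk blkW h.p2 fun a b => le_of_eq (by rw [len_inv_rpow])
  have h2 := hasMaj_l2R_of_transposePair hG hCP p2 p1 hadj.symm
  rw [show -((-1 : ℝ) / 2) = 1 / 2 by norm_num, show (-1 : ℝ) / 2 = -(1 / 2) by norm_num] at h2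
  exact hasMaj_weaken hG hCP le_rfl hr h2

omit [Fintype X] [Fintype V] in
/-- **THE CURRENT LETTER B = Δ(U)∘D_U IN L² FROM (3.117)∕(3.36) AND THE TRANSPOSITION Bᵗ = B†** (Schur): B : 𝔩_W^{(−3/2)} → 𝔩^{(3/2)} with t_Be^{−rd},
r ≦ δ_B — the order (Lʲη)⁻³ of the current J split symmetrically. [cite: Balaban1985BackgroundPropagators, (3.117) p.419 + (3.36) p.396 + p.391] -/
theorem b_l2 (hG : GeoOK g) (h : CurrentMaj blkW blk Bop Bdop R₀ H₀ tB δB) (hadj : IsTransposePair Bop Bdop) (htB : 0 ≤ tB) (hr : r ≤ δB) :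
    HasMaj (l2R R₀ H₀ blkW hG.lenle (-(3 / 2))) (l2R R₀ H₀ blk hG.lenle (3 / 2)) Bop (fun a b => tB * Real.exp (-(r * g.dist a b))) := by
  have b1 : HasMajorantHom (g := toB6 g R₀ H₀) blkW blk Bop (fun (a b : g.Site) => tB * g.len a ^ (-3 : ℝ) * Real.exp (-(δB * g.dist a b))) :=
    hasMajorantHom_mono (g := toB6 g R₀ H₀) blkW blk h.b fun a b => le_of_eq (by rw [len_cube_inv_rpow hG])
  have b2 : HasMajorantHom (g := toB6 g R₀ H₀) blk blkW Bdop (fun (a b : g.Site) => tB * g.len a ^ (-3 : ℝ) * Real.exp (-(δB * g.dist a b))) :=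
    hasMajorantHom_mono (g := toB6 g R₀ H₀) blk blkW h.bd fun a b => le_of_eq (by rw [len_cube_inv_rpow hG])
  have h2 := hasMaj_l2R_of_transposePair hG htB b1 b2 hadj
  rw [show -((-3 : ℝ) / 2) = 3 / 2 by norm_num, show (-3 : ℝ) / 2 = -(3 / 2) by norm_num] at h2
  exact hasMaj_weaken hG htB le_rfl hr h2

omit [Fintype X] [Fintype V] in
/-- **THE TRANSPOSED CURRENT LETTER B† = D\*_U∘Δ(U) IN L²** (Schur): B† : 𝔩^{(−3/2)} → 𝔩_W^{(3/2)} with t_Be^{−rd}, r ≦ δ_B.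
[cite: Balaban1985BackgroundPropagators, (3.117) p.419 + (3.36) p.396 + p.391 + p.421] -/
theorem bd_l2 (hG : GeoOK g) (h : CurrentMaj blkW blk Bop Bdop R₀ H₀ tB δB) (hadj : IsTransposePair Bop Bdop) (htB : 0 ≤ tB) (hr : r ≤ δB) :
    HasMaj (l2R R₀ H₀ blk hG.lenle (-(3 / 2))) (l2R R₀ H₀ blkW hG.lenle (3 / 2)) Bdop (fun a b => tB * Real.exp (-(r * g.dist a b))) := by
  have b1 : HasMajorantHom (g := toB6 g R₀ H₀) blkW blk Bop (fun (a b : g.Site) => tB * g.len a ^ (-3 : ℝ) * Real.exp (-(δB * g.dist a b))) :=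
    hasMajorantHom_mono (g := toB6 g R₀ H₀) blkW blk h.b fun a b => le_of_eq (by rw [len_cube_inv_rpow hG])
  have b2 : HasMajorantHom (g := toB6 g R₀ H₀) blk blkW Bdop (fun (a b : g.Site) => tB * g.len a ^ (-3 : ℝ) * Real.exp (-(δB * g.dist a b))) :=
    hasMajorantHom_mono (g := toB6 g R₀ H₀) blk blkW h.bd fun a b => le_of_eq (by rw [len_cube_inv_rpow hG])
  have h2 := hasMaj_l2R_of_transposePair hG htB b2 b1 hadj.symm
  rw [show -((-3 : ℝ) / 2) = 3 / 2 by norm_num, show (-3 : ℝ) / 2 = -(3 / 2) by norm_num] at h2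
  exact hasMaj_weaken hG htB le_rfl hr h2

end Readings

end

end Literature.MathematicalPhysics.QuantumFieldTheory.Balaban1983to89.B9PerturbationL2Algebra
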